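import Summits.HodgeConjecture.HodgeConjecture.Theorems.Ring2AbelianAllAndreTwistedSquareAnchors
import Summits.HodgeConjecture.HodgeConjecture.Theorems.Ring2WeilCoverageNormCriteria
import HarnessLib

/-!
# Ring 2 · AbelianAll — ANDRÉ AXIS, PART O-b: THE NON-SPLIT POLARIZED TWISTED SQUARES `T × T̄` (`g` odd) —
  every polarized component `(g, d, δ)`, `δ < 0`, contains the twisted squares of every `g`-fold with `ℚ(√−d)`-multiplication;
  the non-split Weil SIXFOLDS `B × B̄`, `E³ × Ē³` typed on the carriers (owed item (o155), abelian-variety level)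

HONEST FRAMING (sub-cell `pub-hodge-ring2-ab-*`, verbatim): research route, not a corollary; conditional on HC_CM plus
one named minimal statement. (Cell `pub-hodge-ring2`, verbatim: research route conditional on HC_CM; not a corollary;
Q11.4-sentence-2 already refuted in dim ≥ 3.) `HC_CM` does not occur in this file. No definition, no named fact, no
`sorry`; ABELIAN-VARIETY level. Inputs: part O-a (`isWeilType_twistedSquare`, `exists_hasWeilDiscriminantNondeg_twistedSquare`:
the weight-`m` polarized twisted square `(T × T, φ × (−φ), L ⊠ L^{⊗m})` has discriminant class `[(−m)^g]`) and tree theorems only.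

* §1 **ODD `g = 2k + 1 ≥ 3`: `exists_nonsplit_polarized_twistedSquare_of_odd`.** The class is `[(−m)^{2k+1}] = [−m]`; if `m ∉ Nm(K_dˣ)`
  it differs from the split class `[(−1)^g] = [−1]`, so the `K`-symmetrised Segre class of weight `m` is NOT hyperbolic
  (`VanGeemen1994.not_isHyperbolicWeilType_of_hasWeilDiscriminantNondeg_ne`, Landherr's easy direction on the carriers): a POLARIZED
  Weil `(4k+2)`-fold of the NON-split component `(2k+1, d, [−m])`. Since every negative class is `[−m]` (part O-a
  `exists_nat_mk_neg_eq`), **every polarized component `(2k+1, d, δ)` with `δ < 0` — split or not — contains the weight-`m` polarized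
  twisted square of EVERY `(2k+1)`-fold `T` with `ℚ(√−d) ⊂ End⁰(T)`** (`exists_polarized_twistedSquare_of_class`), on which the Weil
  classes are algebraic outright (tree) — so the conclusion of the cell's typed target `Ring2.Hypotheses.WeilClassesComponent (2k+1) d δ`
  HOLDS at these members (`weilClassesComponent_body_twistedSquare`), for every `δ` of the right sign (van Geemen 4.14).
* §2 **SIXFOLDS (`g = 3`)**: `nonsplit_weilSixfold_twistedSquare` packages, for every abelian THREEFOLD `T` with `φ² = −d` and every
  `m ∉ Nm(K_dˣ)`: `(T × T, Φ)` is of Weil type `(3, d)`, the weight-`m` Segre class `h` has `det H = [−m] ≠ [−1]`, `(T × T, Φ)` is not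
  hyperbolic for `h`, and `W_K(T × T̄) ⊆ N³`; `…_hodgeConjectureFor`: HC for `T × T` when `T` is a CM threefold (prime dimension,
  number field of degree `6` in `End⁰(T)`) — the anchors `B × B̄` and `E³ × Ē³`; `…_gaussian_three`: `K = ℚ(i)`, `m = 3` (inert, ring-2's
  `natCast_not_mem_normUnitsSubgroup_of_inert`) is such a class. These are the UNCONDITIONAL ANCHORS of the André-axis rows on the
  non-split components `(3, d, [−m])` (parts M-d §2 / N §3–§4), whose chart hypothesis `hWt : IsWeilType (A t) (φ t) 3 d` at the
  anchor is now DISCHARGED by `isWeilType_twistedSquare`; the pencil rows through `B × B̄` are part O-c.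

HONEST REMARKS. (1) «Non-split» is the POLARIZED notion (fixed class `pr₁^*h_K + m·pr₂^*h_K`), the convention of van Geemen 5.3 /
Markman §11.5 Step 1, of `WeilClassesComponent n d δ`, and of the André-axis pencils (relative polarization, constant class along the
pencil by parts L-a/L-g). In the ABSOLUTE convention `IsSplitWeilType` every `T × T̄` with `dim T` odd is split (weight `1`; ab-weil-2's
`isSplitWeilType_prod_of_odd_dim`): a special member of a non-split polarized family may be absolutely split through another
polarization (Néron–Severi rank `> 1`). (2) No case of the Hodge conjecture beyond the tree's is claimed (HC at stably nondegenerate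
`T × T`; Weil classes of twisted squares); the general member of a non-split component is untouched; nothing minimal is claimed;
N104 untouched.

## References

* [vanGeemen1994HodgeAV] B. van Geemen, LNM 1594 (1994), 4.9–4.10, 4.14, Lemma 5.2 (1)–(4), 5.3–5.4 and (5.4.1).
* [Landherr1936HermitianForms] W. Landherr, Abh. Math. Sem. Hamburg 11 (1936) 245–248.
* [Markman2025SurveySecant] E. Markman, arXiv:2509.23403 (unrefereed), §1.1 and §11.5 Step 1.
* [Schoen1998HodgeWeilAddendum] C. Schoen, Compositio Math. 114 (1998), §10.
* [Gordon1999HodgeAVSurvey] B. Gordon (1999), Thm. 6.3 with Remark, Thm. 6.4, Thm. 7.5 (1). [Yanai1985] Remark (p. 172).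
* [Serre1973] J.-P. Serre, A course in arithmetic (1973), Ch. III §1.
* [Andre1996Motifs] Y. André, Publ. Math. IHÉS 83 (1996), §6.3 Lemme 6.3.3 and Remarque 2 (p. 33).
-/

set_option linter.dupNamespace false

noncomputable section

open CategoryTheory
open Literature.AlgebraicGeometry Literature.AlgebraicGeometry.Motives
open Literature.AlgebraicGeometry.HodgeTheory Literature.AlgebraicGeometry.VanGeemen1994
open Literature.AlgebraicTopology.SingularHomology

namespace Summit.HodgeConjecture.HodgeConjecture.Ring2.AbelianAll
/-! ## §1 Odd `g`: the NON-split polarized twisted squares; every negative class is reached -/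

section Odd

variable {T : AbelianVariety ℂ} {k d : ℕ} {φ : T ⟶ T}

/-- **ODD DIMENSION `g = 2k + 1 ≥ 3`: THE POLARIZED TWISTED SQUARE OF WEIGHT `m` HAS CLASS `[−m]`, AND IS NOT HYPERBOLIC WHEN
`m ∉ Nm(K_dˣ)`.** For `dim T = 2k + 1` (`k ≥ 1`), `φ ≫ φ = −d`, `d ≥ 1`: with `e_T`, `a_T`, `h_K` as in §4, for every `m ≥ 1` the
weight-`m` Segre class `h = d·e^*a + Φ^*e^*a = pr₁^*h_K + m·pr₂^*h_K` of `(T × T, Φ = φ × (−φ))` has `det H = [−m]`, and if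
`m ∉ Nm(K_dˣ)` then `[−m] ≠ [−1] = [(−1)^{2k+1}]` and `(T × T, Φ)` is NOT of hyperbolic Weil type for `h` (van Geemen (5.4.1) /
Landherr, contrapositive on the carriers: `not_isHyperbolicWeilType_of_hasWeilDiscriminantNondeg_ne`) — a POLARIZED Weil
`(4k+2)`-fold of the NON-SPLIT component `(2k+1, d, [−m])`. [cite: vanGeemen1994HodgeAV, Lemma 5.2 (3), 5.3–5.4 and (5.4.1)]
[cite: Landherr1936HermitianForms] [cite: Markman2025SurveySecant, §11.5 Step 1] -/
theorem exists_nonsplit_polarized_twistedSquare_of_odd (hk : 1 ≤ k) (hT : T.dim = 2 * k + 1) (hd : 0 < d)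
    (hφ : φ ≫ φ = -(d • 𝟙 T)) :
    ∃ (eT : ProjectiveEmbedding T.X) (aT : complexBetti (projectiveSpace eT.n ℂ) 2),
      IsRationalClass aT ∧ aT ≠ 0 ∧
      ∀ (m : ℕ) (hm : 0 < m),
        ∃ (e : ProjectiveEmbedding (T.prod T).X) (a : complexBetti (projectiveSpace e.n ℂ) 2),
          IsRationalClass a ∧ a ≠ 0 ∧
          (d : ℂ) • complexBetti.map e.ι 2 a +
              complexBetti.map (AbelianVariety.prodLift (AbelianVariety.fst T T ≫ φ)
                (AbelianVariety.snd T T ≫ (-φ))).hom.hom.hom 2 (complexBetti.map e.ι 2 a) =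
            complexBetti.map (AbelianVariety.fst T T).hom.hom.hom 2
                ((d : ℂ) • complexBetti.map eT.ι 2 aT + complexBetti.map φ.hom.hom.hom 2 (complexBetti.map eT.ι 2 aT)) +
              ((m : ℚ) : ℂ) • complexBetti.map (AbelianVariety.snd T T).hom.hom.hom 2
                ((d : ℂ) • complexBetti.map eT.ι 2 aT + complexBetti.map φ.hom.hom.hom 2 (complexBetti.map eT.ι 2 aT)) ∧
          HasWeilDiscriminantNondeg (T.prod T)
            (AbelianVariety.prodLift (AbelianVariety.fst T T ≫ φ) (AbelianVariety.snd T T ≫ (-φ))) (2 * k + 1) d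
            ((d : ℂ) • complexBetti.map e.ι 2 a +
              complexBetti.map (AbelianVariety.prodLift (AbelianVariety.fst T T ≫ φ)
                (AbelianVariety.snd T T ≫ (-φ))).hom.hom.hom 2 (complexBetti.map e.ι 2 a))
            (QuotientGroup.mk (-Units.mk0 (m : ℚ) (Nat.cast_ne_zero.2 hm.ne'))) ∧
          (Units.mk0 (m : ℚ) (Nat.cast_ne_zero.2 hm.ne') ∉ normUnitsSubgroup ℚ (weilField d) →
            ¬ IsHyperbolicWeilType (T.prod T)
              (AbelianVariety.prodLift (AbelianVariety.fst T T ≫ φ) (AbelianVariety.snd T T ≫ (-φ))) (2 * k + 1)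
              ((d : ℂ) • complexBetti.map e.ι 2 a +
                complexBetti.map (AbelianVariety.prodLift (AbelianVariety.fst T T ≫ φ)
                  (AbelianVariety.snd T T ≫ (-φ))).hom.hom.hom 2 (complexBetti.map e.ι 2 a))) := by
  have hT' : T.dim = 2 * k + 1 := hT
  obtain ⟨eT, aT, haT, haT0, hall⟩ :=
    exists_hasWeilDiscriminantNondeg_twistedSquare (m₀ := 2 * k) (by omega) hT' hd hφ
  refine ⟨eT, aT, haT, haT0, fun m hm ↦ ?_⟩
  obtain ⟨e, a, w, ha, ha0, hw, hh, hδ⟩ := hall m hm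
  have hmQ : (m : ℚ) ≠ 0 := Nat.cast_ne_zero.2 hm.ne'
  -- `[w] = [(−m)^{2k+1}] = [−m]`
  have hweq : w = (-Units.mk0 (m : ℚ) hmQ) ^ (2 * k + 1) :=
    Units.ext (by rw [hw, Units.val_pow_eq_pow_val, Units.val_neg, Units.val_mk0])
  rw [hweq, weilNormResidueGroup_mk_pow_odd] at hδ
  refine ⟨e, a, ha, ha0, hh, hδ, fun hnorm ↦ ?_⟩
  have hne : (QuotientGroup.mk (-Units.mk0 (m : ℚ) hmQ) : weilNormResidueGroup d) ≠
      QuotientGroup.mk ((-1 : ℚˣ) ^ (2 * k + 1)) := by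
    rw [Odd.neg_one_pow ⟨k, rfl⟩]
    exact (weilNormResidueGroup_mk_neg_ne_mk_neg_one_iff _).2 hnorm
  exact not_isHyperbolicWeilType_of_hasWeilDiscriminantNondeg_ne (by omega) (dim_twistedSquare hT) hd
    (twistedSquare_comp_self hφ) e ha ha0 hδ hne

/-- **EVERY POLARIZED COMPONENT `(g, d, δ)` WITH `g` ODD AND `δ < 0` CONTAINS THE POLARIZED TWISTED SQUARES OF EVERY `g`-FOLD WITH
`ℚ(√−d)`-MULTIPLICATION** (split or not; van Geemen 4.14: the components are indexed by the classes `x` with `(−1)^g x > 0`):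
for `dim T = 2k + 1 ≥ 3`, `φ ≫ φ = −d` and every `q ∈ ℚˣ` with `q < 0` there are a projective embedding `e` of `T × T` and a rational
`a ≠ 0` whose `K`-symmetrised class has a non-degenerate discriminant witness of class `[q]` for `(T × T, φ × (−φ))` — which is of
Weil type `(2k+1, d)` (§1) with ALGEBRAIC Weil plane (tree). So the cell's typed targets `WeilClassesComponent (2k+1) d [q]` all
have members at which their conclusion holds outright. [cite: vanGeemen1994HodgeAV, 4.14 and 5.3] [cite: Markman2025SurveySecant, §11.5 Step 1] -/
theorem exists_polarized_twistedSquare_of_class (hk : 1 ≤ k) (hT : T.dim = 2 * k + 1) (hd : 0 < d)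
    (hφ : φ ≫ φ = -(d • 𝟙 T)) (q : ℚˣ) (hq : (q : ℚ) < 0) :
    ∃ (e : ProjectiveEmbedding (T.prod T).X) (a : complexBetti (projectiveSpace e.n ℂ) 2),
      IsRationalClass a ∧ a ≠ 0 ∧
      IsWeilType (T.prod T)
        (AbelianVariety.prodLift (AbelianVariety.fst T T ≫ φ) (AbelianVariety.snd T T ≫ (-φ))) (2 * k + 1) d ∧
      HasWeilDiscriminantNondeg (T.prod T)
        (AbelianVariety.prodLift (AbelianVariety.fst T T ≫ φ) (AbelianVariety.snd T T ≫ (-φ))) (2 * k + 1) d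
        ((d : ℂ) • complexBetti.map e.ι 2 a +
          complexBetti.map (AbelianVariety.prodLift (AbelianVariety.fst T T ≫ φ)
            (AbelianVariety.snd T T ≫ (-φ))).hom.hom.hom 2 (complexBetti.map e.ι 2 a))
        (QuotientGroup.mk q) ∧
      weilClassesOf (T.prod T)
          (AbelianVariety.prodLift (AbelianVariety.fst T T ≫ φ) (AbelianVariety.snd T T ≫ (-φ))) (2 * k + 1) d ≤
        algebraicClasses (T.prod T).X (2 * k + 1) := by
  obtain ⟨m, hm, hmq⟩ := exists_nat_mk_neg_eq (d := d) q hq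
  obtain ⟨eT, aT, -, -, hall⟩ := exists_nonsplit_polarized_twistedSquare_of_odd hk hT hd hφ
  obtain ⟨e, a, ha, ha0, -, hδ, -⟩ := hall m hm
  rw [hmq] at hδ
  exact ⟨e, a, ha, ha0, isWeilType_twistedSquare (by omega) hT hd hφ, hδ,
    weilClassesOf_twistedSquare_le_algebraicClasses (by omega) hT hd hφ⟩

/-- **The conclusion of the cell's typed target `WeilClassesComponent (2k+1) d δ` HOLDS AT the twisted squares**, for EVERY class
`δ` and every `K`-symmetrised hyperplane class (its body, verbatim, at `A = T × T`, `φ_A = φ × (−φ)`; the discriminant hypothesis is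
carried and not used): every rational Hodge `(2k+1, 2k+1)`-class of the Weil plane is algebraic — the tree's
`weilClassesOf_twistedSquare_le_algebraicClasses`. With `exists_polarized_twistedSquare_of_class`: no component `(2k+1, d, δ)`,
`δ < 0`, is a statement only about members where nothing is known. [cite: vanGeemen1994HodgeAV, 4.9, 4.14 and 5.3]
[cite: Schoen1998HodgeWeilAddendum, §10] -/
theorem weilClassesComponent_body_twistedSquare (hk : 1 ≤ k) (hT : T.dim = 2 * k + 1) (hd : 0 < d)
    (hφ : φ ≫ φ = -(d • 𝟙 T)) (δ : weilNormResidueGroup d) :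
    ∀ (e : ProjectiveEmbedding (T.prod T).X) (a : complexBetti (projectiveSpace e.n ℂ) 2), IsRationalClass a → a ≠ 0 →
      HasWeilDiscriminantNondeg (T.prod T)
          (AbelianVariety.prodLift (AbelianVariety.fst T T ≫ φ) (AbelianVariety.snd T T ≫ (-φ))) (2 * k + 1) d
          ((d : ℂ) • complexBetti.map e.ι 2 a +
            complexBetti.map (AbelianVariety.prodLift (AbelianVariety.fst T T ≫ φ)
              (AbelianVariety.snd T T ≫ (-φ))).hom.hom.hom 2 (complexBetti.map e.ι 2 a)) δ →
        ∀ c : complexBetti (T.prod T).X (2 * (2 * k + 1)), IsRationalClass c →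
          IsOfHodgeType (2 * (2 * k + 1)) (T.prod T).X (2 * (2 * k + 1)) (2 * k + 1) (2 * k + 1) c →
            c ∈ weilClassesOf (T.prod T)
                (AbelianVariety.prodLift (AbelianVariety.fst T T ≫ φ) (AbelianVariety.snd T T ≫ (-φ))) (2 * k + 1) d →
              c ∈ algebraicClasses (T.prod T).X (2 * k + 1) :=
  fun _ _ _ _ _ _ _ _ hc ↦ weilClassesOf_twistedSquare_le_algebraicClasses (by omega) hT hd hφ hc

end Odd

/-! ## §2 Sixfolds: the anchors `T × T̄` of the non-split components `(3, d, [−m])` -/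

section Sixfolds

variable {T : AbelianVariety ℂ} {d : ℕ} {φ : T ⟶ T}

/-- **THE NON-SPLIT WEIL SIXFOLDS `T × T̄`.** For every complex abelian THREEFOLD `T` with `φ ≫ φ = −(d • 𝟙 T)`, `d ≥ 1`, and every
`m ≥ 1` with `m ∉ Nm(ℚ(√−d)ˣ)`: some projective embedding `e` of `T × T` with a rational `a ≠ 0` (the weight-`m` Segre embedding on
one embedding of `T`) makes `(T × T, φ × (−φ), h = d·e^*a + Φ^*e^*a)` a POLARIZED WEIL SIXFOLD — Weil type `(3, d)` — with
`det H = [−m] ≠ [−1]`, NOT hyperbolic for `h` (non-split component `(3, d, [−m])`), whose Weil plane is ALGEBRAIC. These are the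
anchors `B × B̄` (CM threefold `B`), `E³ × Ē³`, and the twisted squares of Picard-type threefolds, now typed on the carriers.
[cite: vanGeemen1994HodgeAV, 4.9, Lemma 5.2 (3), 5.3–5.4 and (5.4.1)] [cite: Landherr1936HermitianForms]
[cite: Schoen1998HodgeWeilAddendum, §10] [cite: Markman2025SurveySecant, §11.5 Step 1] -/
theorem nonsplit_weilSixfold_twistedSquare (hT : T.dim = 3) (hd : 0 < d) (hφ : φ ≫ φ = -(d • 𝟙 T))
    {m : ℕ} (hm : 0 < m) (hnorm : Units.mk0 (m : ℚ) (Nat.cast_ne_zero.2 hm.ne') ∉ normUnitsSubgroup ℚ (weilField d)) :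
    ∃ (e : ProjectiveEmbedding (T.prod T).X) (a : complexBetti (projectiveSpace e.n ℂ) 2),
      IsRationalClass a ∧ a ≠ 0 ∧
      IsWeilType (T.prod T)
        (AbelianVariety.prodLift (AbelianVariety.fst T T ≫ φ) (AbelianVariety.snd T T ≫ (-φ))) 3 d ∧
      HasWeilDiscriminantNondeg (T.prod T)
        (AbelianVariety.prodLift (AbelianVariety.fst T T ≫ φ) (AbelianVariety.snd T T ≫ (-φ))) 3 d
        ((d : ℂ) • complexBetti.map e.ι 2 a +
          complexBetti.map (AbelianVariety.prodLift (AbelianVariety.fst T T ≫ φ)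
            (AbelianVariety.snd T T ≫ (-φ))).hom.hom.hom 2 (complexBetti.map e.ι 2 a))
        (QuotientGroup.mk (-Units.mk0 (m : ℚ) (Nat.cast_ne_zero.2 hm.ne'))) ∧
      (QuotientGroup.mk (-Units.mk0 (m : ℚ) (Nat.cast_ne_zero.2 hm.ne')) : weilNormResidueGroup d) ≠
        QuotientGroup.mk ((-1 : ℚˣ) ^ 3) ∧
      ¬ IsHyperbolicWeilType (T.prod T)
          (AbelianVariety.prodLift (AbelianVariety.fst T T ≫ φ) (AbelianVariety.snd T T ≫ (-φ))) 3
          ((d : ℂ) • complexBetti.map e.ι 2 a +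
            complexBetti.map (AbelianVariety.prodLift (AbelianVariety.fst T T ≫ φ)
              (AbelianVariety.snd T T ≫ (-φ))).hom.hom.hom 2 (complexBetti.map e.ι 2 a)) ∧
      weilClassesOf (T.prod T)
          (AbelianVariety.prodLift (AbelianVariety.fst T T ≫ φ) (AbelianVariety.snd T T ≫ (-φ))) 3 d ≤
        algebraicClasses (T.prod T).X 3 := by
  have hT' : T.dim = 2 * 1 + 1 := by rw [hT]
  obtain ⟨eT, aT, -, -, hall⟩ := exists_nonsplit_polarized_twistedSquare_of_odd (k := 1) le_rfl hT' hd hφ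
  obtain ⟨e, a, ha, ha0, -, hδ, hnh⟩ := hall m hm
  have hne : (QuotientGroup.mk (-Units.mk0 (m : ℚ) (Nat.cast_ne_zero.2 hm.ne')) : weilNormResidueGroup d) ≠
      QuotientGroup.mk ((-1 : ℚˣ) ^ 3) := by
    rw [Odd.neg_one_pow (by decide : Odd 3)]
    exact (weilNormResidueGroup_mk_neg_ne_mk_neg_one_iff _).2 hnorm
  exact ⟨e, a, ha, ha0, isWeilType_twistedSquare (by norm_num) hT hd hφ, hδ, hne, hnh hnorm,
    weilClassesOf_twistedSquare_le_algebraicClasses (by norm_num) hT hd hφ⟩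

/-- **… and the Hodge conjecture holds for these non-split Weil sixfolds when `T` is a CM threefold** (`dim T = 3` prime, a number
field of degree `6` in `End⁰(T)`: the anchors `B × B̄` of the non-split components and `E³ × Ē³`) — UNCONDITIONALLY, by §1.
[cite: Gordon1999HodgeAVSurvey, Thm. 6.3 with Remark, Thm. 6.4, Thm. 7.5 (1)] [cite: Yanai1985, Remark (p. 172)]
[cite: Andre1996Motifs, §6.3 Lemme 6.3.3 and Remarque 2 (p. 33)] -/
theorem nonsplit_weilSixfold_twistedSquare_hodgeConjectureFor (hT : T.dim = 3) {F : Type} [Field F] [NumberField F]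
    (ιF : F →+* T.endAlgebra) (hF : Module.finrank ℚ F = 6) :
    HodgeConjectureFor (T.prod T).dim (T.prod T).X :=
  hodgeConjectureFor_twistedSquare_of_endField ιF (by rw [hF, hT]) (by rw [hT]; norm_num)

/-- **A CONCRETE NON-SPLIT CLASS: `K = ℚ(i)`, weight `m = 3`.** `3` is inert in `ℚ(i)` (`−1` is not a square mod `3`), so
`3 ∉ Nm(ℚ(i)ˣ)` (ring-2's `natCast_not_mem_normUnitsSubgroup_of_inert`), and for every abelian threefold `T` with `φ² = −1` the
weight-`3` polarized twisted square `(T × T, φ × (−φ), L ⊠ L^{⊗3})` is a NON-split Gaussian Weil sixfold of class `[−3]`.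
[cite: Serre1973, Ch. III §1] [cite: vanGeemen1994HodgeAV, 5.3–5.4 and (5.4.1)] -/
theorem nonsplit_weilSixfold_twistedSquare_gaussian_three (hT : T.dim = 3) (hφ : φ ≫ φ = -((1 : ℕ) • 𝟙 T)) :
    ∃ (e : ProjectiveEmbedding (T.prod T).X) (a : complexBetti (projectiveSpace e.n ℂ) 2),
      IsRationalClass a ∧ a ≠ 0 ∧
      IsWeilType (T.prod T)
        (AbelianVariety.prodLift (AbelianVariety.fst T T ≫ φ) (AbelianVariety.snd T T ≫ (-φ))) 3 1 ∧
      HasWeilDiscriminantNondeg (T.prod T)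
        (AbelianVariety.prodLift (AbelianVariety.fst T T ≫ φ) (AbelianVariety.snd T T ≫ (-φ))) 3 1
        (((1 : ℕ) : ℂ) • complexBetti.map e.ι 2 a +
          complexBetti.map (AbelianVariety.prodLift (AbelianVariety.fst T T ≫ φ)
            (AbelianVariety.snd T T ≫ (-φ))).hom.hom.hom 2 (complexBetti.map e.ι 2 a))
        (QuotientGroup.mk (-Units.mk0 ((3 : ℕ) : ℚ) (by norm_num))) ∧
      ¬ IsHyperbolicWeilType (T.prod T)
          (AbelianVariety.prodLift (AbelianVariety.fst T T ≫ φ) (AbelianVariety.snd T T ≫ (-φ))) 3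
          (((1 : ℕ) : ℂ) • complexBetti.map e.ι 2 a +
            complexBetti.map (AbelianVariety.prodLift (AbelianVariety.fst T T ≫ φ)
              (AbelianVariety.snd T T ≫ (-φ))).hom.hom.hom 2 (complexBetti.map e.ι 2 a)) := by
  have h3 : Units.mk0 ((3 : ℕ) : ℚ) (by norm_num) ∉ normUnitsSubgroup ℚ (weilField 1) :=
    WeilCoverage.natCast_not_mem_normUnitsSubgroup_of_inert (d := 1) (a := 3) (p := 3) Nat.prime_three (by decide)
      (dvd_refl 3) (by norm_num) (by norm_num)
  obtain ⟨e, a, ha, ha0, hW, hδ, -, hnh, -⟩ :=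
    nonsplit_weilSixfold_twistedSquare hT one_pos hφ (m := 3) (by norm_num) h3
  exact ⟨e, a, ha, ha0, hW, hδ, hnh⟩

end Sixfolds
end Summit.HodgeConjecture.HodgeConjecture.Ring2.AbelianAll

end
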